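import Summits.HodgeConjecture.HodgeConjecture.Theorems.F0P3cStCharTSUprLc            -- ★ p851605 (F0P3-p02 g20) «UPR-LC★»: brings ★ MovingRoot, ★ RootCount, ★ RootPersist, ★ MovingSection, ★ NormOnePersist, ★ NormOneRootsNear, ★ EllOpen
import HarnessLib

/-!
# F0 · P3c · line LH6 «StCharTS» — «MOVING-FRAME★» (bricks (M1)(M2)(M3) of «UP-MEAS∀», PLAN `F0/P3/F0P3-p02/g21/UPMEAS-PLAN.v1.F0P3p02g21.md`): the norm-one roots of
# `charpoly y` and the matched `H_v`-sections move CONTINUOUSLY ON A NEIGHBOURHOOD of every regular `x ∈ U(Φ₃)(L⁺_v)` — the «eventually at `x`» bricks of ★ S13b «UPR-LC» upgraded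
# from `ContinuousAt x` to continuity at EVERY point of an open set (what measurability of `α ↦ α^G` at a merely measurable `α` needs)

Cell `pub/hodgecm-mathlib`, crux H413 = `stmt-HodgeConjecture-24833` (lane `--supports … --as helper`), route HCCMUnconditional; seat F0P3-p02 (g21); datum road of the (S-𝔇)
organ `stub_EllipticPackage`, row `up` (MAP v5 §3: «UpSpec (2)(3) remain NAMED»; (2) is ★ UP-CLASS p851684; this file serves (1) at NON-locally-constant `α`).
THEOREMS ONLY (no definition ∕ instance ∕ notation ∕ named fact ∕ `sorry`); ★-only imports.  HONEST LABEL: HC_CM is proved only modulo the 7 printed citations (2 remaining named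
inputs: hLiu418 = `stmt-HodgeConjecture-24832`, h413 = `stmt-HodgeConjecture-24833`) until rung 0 closes; this file closes no organ and is count-neutral.

* §1 (M1, generic complete normed field) `continuousAt_of_window` — a window root is continuous wherever it is simple; `exists_root_continuousOn` — ★ MOVING-ROOT's selector is
  continuous at every point of an open set on which the polynomial stays separable.
* §2 (M2, `U(Φ₃)(L⁺_v)`, `v` non-split) `exists_norm_one_frame` — at a regular `x`: an open `V ∋ x` of regular elements, the finset `A` of norm-one roots of `(charpoly x)_w` and root
  functions `u_a` continuous ON `V`, norm-one roots of `(charpoly y)_w` for every `y ∈ V`, pairwise distinct, and EXHAUSTING the norm-one roots of `(charpoly y)_w` (★ NORM-ONE-PERSIST,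
  ★ NORM-ONE-ROOTS-NEAR, ★ `exists_pos_separating`).
* §3 (M3) `exists_section_continuousOn` — ★ MOVING-SECTION's explicit section `s(y) = ([[0, (σk)⁻¹], [k, tr y − U]], (U))` is continuous at every point of the open set
  `V ∩ {k a unit}` when `U` is continuous on `V` (chart `k` frozen at the base point).

## References
* [Rogawski1990] J. D. Rogawski, *Automorphic Representations of Unitary Groups in Three Variables*, Ann. of Math. Stud. 123 (1990): §4.3 p. 43, §5.4 p. 78, §12.5 pp. 182–184
  (L. 12.5.1: the matched classes of a regular `γ` and their `U(1)`-slots).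
* [CasselsFrohlichANT1967] J. W. S. Cassels, A. Fröhlich (eds.), *Algebraic Number Theory* (1967), Ch. II (complete fields; continuity of roots — folklore form used via ★ RootPersist).
-/

set_option autoImplicit false
-- the mandated namespace has the single-problem summit's repeated segment (`HodgeConjecture.HodgeConjecture`)
set_option linter.dupNamespace false

noncomputable section

open Polynomial Filter Topology Metric Set
open NumberField IsDedekindDomain
open scoped Matrix MatrixGroups
open Literature.NumberTheory.Automorphic Literature.NumberTheory.Automorphic.UnitaryGroup
open Literature.NumberTheory.Rogawski1990 Literature.NumberTheory.GaloisRepresentations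
open Summit.HodgeConjecture.HodgeConjecture.Cruxes.H413.F0P3cStCharTSRootPersist (exists_root_near_of_simple_root)
open Summit.HodgeConjecture.HodgeConjecture.Cruxes.H413.F0P3cStCharTSMovingRoot (eventually_forall_norm_coeff_sub_lt exists_continuousAt_root)
open Summit.HodgeConjecture.HodgeConjecture.Cruxes.H413.F0P3cStCharTSMovingSection

namespace Summit.HodgeConjecture.HodgeConjecture.Cruxes.H413.F0P3cStCharTSMovingFrame

/-! ## §1 (M1) Window roots are continuous on an open set -/

section RootContOn

variable {K : Type*} [NormedField K] [CompleteSpace K] {Y : Type*} [TopologicalSpace Y]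

/-- **A window root is continuous wherever it is simple.**  `f : Y → K[X]` with `natDegree (f y) < N` near `y₁` and coefficients continuous at `y₁`; `u : Y → K` a root
selector which, near `y₁`, picks a root of `f y` in the window `‖· − a‖ < δ` and is the ONLY root there; if the root `u y₁` of `f y₁` is simple, then `u` is continuous at `y₁`
(★ P1 `exists_root_near_of_simple_root` at `y₁` + uniqueness in the window). [folklore] -/
theorem continuousAt_of_window (f : Y → K[X]) {N : ℕ} {y₁ : Y} (hdeg : ∀ᶠ y in 𝓝 y₁, (f y).natDegree < N)
    (hcoeff : ∀ i, ContinuousAt (fun y => (f y).coeff i) y₁) {u : Y → K} {a : K} {δ : ℝ}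
    (hwin : ∀ᶠ y in 𝓝 y₁, (f y).IsRoot (u y) ∧ ‖u y - a‖ < δ ∧ ∀ r, (f y).IsRoot r → ‖r - a‖ < δ → r = u y)
    (hsimple : (derivative (f y₁)).eval (u y₁) ≠ 0) : ContinuousAt u y₁ := by
  have h₁ : (f y₁).natDegree < N := hdeg.self_of_nhds
  obtain ⟨hroot₁, hwin₁, -⟩ := hwin.self_of_nhds
  rw [ContinuousAt, Metric.tendsto_nhds]
  intro ε hε
  have hgap : 0 < δ - ‖u y₁ - a‖ := sub_pos.2 hwin₁
  obtain ⟨ρ, hρ, hex⟩ := exists_root_near_of_simple_root h₁ hroot₁ hsimple (lt_min hε hgap)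
  filter_upwards [hdeg, eventually_forall_norm_coeff_sub_lt f hdeg hcoeff hρ, hwin] with y hyN hyc hyw
  obtain ⟨r, hr, hru⟩ := hex (f y) hyN hyc
  have hra : ‖r - a‖ < δ := by
    calc ‖r - a‖ = ‖(r - u y₁) + (u y₁ - a)‖ := by rw [sub_add_sub_cancel]
      _ ≤ ‖r - u y₁‖ + ‖u y₁ - a‖ := norm_add_le _ _
      _ < (δ - ‖u y₁ - a‖) + ‖u y₁ - a‖ := by gcongr; exact lt_of_lt_of_le hru (min_le_right _ _)
      _ = δ := sub_add_cancel δ _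
  rw [dist_eq_norm, ← hyw.2.2 r hr hra]
  exact lt_of_lt_of_le hru (min_le_left _ _)

/-- **The moving root, continuous ON a neighbourhood (ROOT-CONT-ON★).**  `K` complete; `f : Y → K[X]` with `natDegree (f y) < N` everywhere, coefficients continuous
everywhere, and `f y` SEPARABLE at every point of an open set `W ∋ y₀`; `a` a root of `f y₀`.  Then there are a window `δ > 0`, an open `V` with `y₀ ∈ V ⊆ W`, and
`u : Y → K` with `u y₀ = a`, `u` continuous at EVERY point of `V`, and for all `y ∈ V`: `u y` is a root of `f y`, `‖u y − a‖ < δ`, and it is the only root of `f y` in that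
window. [folklore] -/
theorem exists_root_continuousOn (f : Y → K[X]) {N : ℕ} (hdeg : ∀ y, (f y).natDegree < N)
    (hcoeff : ∀ i, Continuous fun y => (f y).coeff i) {W : Set Y} (hW : IsOpen W) {y₀ : Y} (hy₀ : y₀ ∈ W)
    (hsep : ∀ y ∈ W, (f y).Separable) {a : K} (ha₀ : (f y₀).IsRoot a) :
    ∃ (δ : ℝ) (V : Set Y) (u : Y → K), 0 < δ ∧ IsOpen V ∧ y₀ ∈ V ∧ V ⊆ W ∧ u y₀ = a ∧ (∀ y ∈ V, ContinuousAt u y) ∧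
      ∀ y ∈ V, (f y).IsRoot (u y) ∧ ‖u y - a‖ < δ ∧ ∀ r, (f y).IsRoot r → ‖r - a‖ < δ → r = u y := by
  have hsimple : ∀ y ∈ W, ∀ r, (f y).IsRoot r → (derivative (f y)).eval r ≠ 0 := fun y hy r hr =>
    F0P3cStCharTSRootCount.eval_derivative_ne_zero_of_separable (hsep y hy) r ((mem_roots (hsep y hy).ne_zero).2 hr)
  obtain ⟨δ, u, hδ, hu0, -, hev⟩ := exists_continuousAt_root f (Eventually.of_forall hdeg) (fun i => (hcoeff i).continuousAt) ha₀
    (hsimple y₀ hy₀ a ha₀)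
  obtain ⟨V₁, hV₁sub, hV₁open, hy₀V₁⟩ := mem_nhds_iff.1 hev
  refine ⟨δ, V₁ ∩ W, u, hδ, hV₁open.inter hW, ⟨hy₀V₁, hy₀⟩, inter_subset_right, hu0, fun y hy => ?_, fun y hy => hV₁sub hy.1⟩
  have hwin : ∀ᶠ y' in 𝓝 y, (f y').IsRoot (u y') ∧ ‖u y' - a‖ < δ ∧ ∀ r, (f y').IsRoot r → ‖r - a‖ < δ → r = u y' :=
    Filter.mem_of_superset (hV₁open.mem_nhds hy.1) hV₁sub
  exact continuousAt_of_window f (Eventually.of_forall hdeg) (fun i => (hcoeff i).continuousAt) hwin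
    (hsimple y hy.2 (u y) (hV₁sub hy.1).1)

end RootContOn

/-! ## §2 (M2) The norm-one frame on a neighbourhood of a regular point -/

section Frame

variable (L : Type) [Field L] [NumberField L] [IsCMField L] (v : HeightOneSpectrum (𝓞 ↥(maximalRealSubfield L)))

/-- **THE NORM-ONE FRAME (M2).**  At a regular `x ∈ U(Φ₃)(L⁺_v)` (`v` non-split, `w ∣ v`): an open set `V ∋ x` of regular elements, the finset `A` of norm-one roots of `P_x = (charpoly x)_w`
and root functions `u_a : U(Φ₃)(L⁺_v) → L_w` (`a ∈ A`, `u_a x = a`) CONTINUOUS AT EVERY POINT OF `V` such that for every `y ∈ V`: each `u_a y` is a norm-one root of `P_y`, the `u_a y` are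
pairwise distinct, and every norm-one root of `P_y` is some `u_a y`. [cite: Rogawski1990, §5.4 p. 78; §12.5 pp. 182–184] -/
theorem exists_norm_one_frame (w : PlacesOver L v) (hw : IsCMField.complexConj L • w.1 = w.1) (x : Gqs L v)
    (hx : IsRegularElt (x.val : GL (Fin 3) (UnitaryGroup.LocalRing L v))) :
    ∃ (V : Set (Gqs L v)) (A : Finset (w.1.adicCompletion L)) (u : w.1.adicCompletion L → Gqs L v → w.1.adicCompletion L),
      IsOpen V ∧ x ∈ V ∧ (∀ y ∈ V, IsRegularElt (y.val : GL (Fin 3) (UnitaryGroup.LocalRing L v))) ∧ (∀ a ∈ A, u a x = a) ∧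
      (∀ a ∈ A, ∀ y ∈ V, ContinuousAt (u a) y) ∧
      (∀ a ∈ A, ∀ y ∈ V, (((y.val : GL (Fin 3) (UnitaryGroup.LocalRing L v)).val.charpoly).map (Pi.evalRingHom (fun w' : PlacesOver L v => w'.1.adicCompletion L) w)).IsRoot (u a y) ∧
        galAdicCompletionMap (L := L) (IsCMField.complexConj L) hw (u a y) * u a y = 1) ∧
      (∀ y ∈ V, ∀ a ∈ A, ∀ a' ∈ A, u a y = u a' y → a = a') ∧
      (∀ y ∈ V, ∀ r : w.1.adicCompletion L,
        (((y.val : GL (Fin 3) (UnitaryGroup.LocalRing L v)).val.charpoly).map (Pi.evalRingHom (fun w' : PlacesOver L v => w'.1.adicCompletion L) w)).IsRoot r →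
          galAdicCompletionMap (L := L) (IsCMField.complexConj L) hw r * r = 1 → ∃ a ∈ A, r = u a y) := by
  classical
  haveI : ProperSpace (w.1.adicCompletion L) := properSpace_adicCompletion L w.1
  set φ := Pi.evalRingHom (fun w' : PlacesOver L v => w'.1.adicCompletion L) w with hφ
  set σw := galAdicCompletionMap (L := L) (IsCMField.complexConj L) hw with hσw
  set P : Gqs L v → (w.1.adicCompletion L)[X] := fun y => ((y.val : GL (Fin 3) (UnitaryGroup.LocalRing L v)).val.charpoly).map φ with hP
  have hP0 : ∀ y, P y ≠ 0 := fun y => (F0P3cStCharTSNormOneRootsNear.monic_map_charpoly L v w y).ne_zero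
  -- the regular set is open and `P y` is separable there
  set W : Set (Gqs L v) := {y | IsRegularElt (y.val : GL (Fin 3) (UnitaryGroup.LocalRing L v))} with hW
  have hWopen : IsOpen W := isOpen_iff_mem_nhds.2 fun _ hy => eventually_isRegularElt L v hy
  have hsepW : ∀ y ∈ W, (P y).Separable := fun y hy => Polynomial.Separable.map hy
  -- the old norm-one roots `A`
  set A : Finset (w.1.adicCompletion L) := (P x).roots.toFinset.filter (fun a => σw a * a = 1) with hAdef
  have hAroot : ∀ a ∈ A, (P x).IsRoot a := fun a ha => (mem_roots (hP0 x)).1 (Multiset.mem_toFinset.1 (Finset.mem_filter.1 ha).1)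
  have hA1 : ∀ a ∈ A, σw a * a = 1 := fun a ha => (Finset.mem_filter.1 ha).2
  have hA : ∀ a, (P x).IsRoot a → σw a * a = 1 → a ∈ A := fun a hr h1 =>
    Finset.mem_filter.2 ⟨Multiset.mem_toFinset.2 ((mem_roots (hP0 x)).2 hr), h1⟩
  -- (M1) for each `a ∈ A`: a window `δ a`, an open `Va a ∋ x` inside `W`, a root function `u a` continuous on `Va a`
  have hdeg : ∀ y, (P y).natDegree < 4 := fun y => by
    show (((y.val : GL (Fin 3) (UnitaryGroup.LocalRing L v)).val.charpoly).map _).natDegree < 4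
    rw [F0P3cStCharTSNormOneRootsNear.natDegree_map_charpoly]; norm_num
  have hcoeff : ∀ i, Continuous fun y => (P y).coeff i := fun i => by
    simpa only [hP, coeff_map] using F0P3cStCharTSEllOpen.continuous_evalPlace_charpoly_coeff L v w i
  have hM1 : ∀ a : w.1.adicCompletion L, ∃ (δ : ℝ) (Va : Set (Gqs L v)) (ua : Gqs L v → w.1.adicCompletion L), a ∈ A →
      0 < δ ∧ IsOpen Va ∧ x ∈ Va ∧ Va ⊆ W ∧ ua x = a ∧ (∀ y ∈ Va, ContinuousAt ua y) ∧
        ∀ y ∈ Va, (P y).IsRoot (ua y) ∧ ‖ua y - a‖ < δ ∧ ∀ r, (P y).IsRoot r → ‖r - a‖ < δ → r = ua y := fun a => by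
    by_cases ha : a ∈ A
    · obtain ⟨δ, Va, ua, hδ, hVa, hxVa, hVaW, hua0, huac, hwin⟩ := exists_root_continuousOn P hdeg hcoeff hWopen hx hsepW (hAroot a ha)
      exact ⟨δ, Va, ua, fun _ => ⟨hδ, hVa, hxVa, hVaW, hua0, huac, hwin⟩⟩
    · exact ⟨1, Set.univ, fun _ => 0, fun h => absurd h ha⟩
  choose δ Va u hM1 using hM1
  have hδ : ∀ a ∈ A, 0 < δ a := fun a ha => (hM1 a ha).1
  have hVao : ∀ a ∈ A, IsOpen (Va a) := fun a ha => (hM1 a ha).2.1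
  have hxVa : ∀ a ∈ A, x ∈ Va a := fun a ha => (hM1 a ha).2.2.1
  have hVaW : ∀ a ∈ A, Va a ⊆ W := fun a ha => (hM1 a ha).2.2.2.1
  have hu0 : ∀ a ∈ A, u a x = a := fun a ha => (hM1 a ha).2.2.2.2.1
  have huc : ∀ a ∈ A, ∀ y ∈ Va a, ContinuousAt (u a) y := fun a ha => (hM1 a ha).2.2.2.2.2.1
  have hwinV : ∀ a ∈ A, ∀ y ∈ Va a, (P y).IsRoot (u a y) ∧ ‖u a y - a‖ < δ a ∧ ∀ r, (P y).IsRoot r → ‖r - a‖ < δ a → r = u a y :=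
    fun a ha => (hM1 a ha).2.2.2.2.2.2
  have hwin : ∀ a ∈ A, ∀ᶠ y in 𝓝 x, (P y).IsRoot (u a y) ∧ ‖u a y - a‖ < δ a ∧ ∀ r, (P y).IsRoot r → ‖r - a‖ < δ a → r = u a y :=
    fun a ha => Filter.mem_of_superset ((hVao a ha).mem_nhds (hxVa a ha)) (hwinV a ha)
  -- ★ NORM-ONE-PERSIST at `x`, ★ NORM-ONE-ROOTS-NEAR at `x`, distinctness near `x` — all eventually, combined over the finset `A`
  have hn1 : ∀ᶠ y in 𝓝 x, ∀ a ∈ A, σw (u a y) * u a y = 1 := by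
    rw [Filter.eventually_all_finset]
    intro a ha
    exact F0P3cStCharTSNormOnePersist.eventually_conj_mul_self_eq_one L v w hw (hδ a ha) (hu0 a ha) (huc a ha x (hxVa a ha)) (hA1 a ha) (hwin a ha)
  have hexh : ∀ᶠ y in 𝓝 x, ∀ r, (P y).IsRoot r → σw r * r = 1 → ∃ a ∈ A, r = u a y :=
    F0P3cStCharTSNormOneRootsNear.eventually_forall_norm_one_root_eq L v w hw x A hA u δ hδ (fun a ha => (hwin a ha).mono fun y hy => hy.2.2)
  obtain ⟨ε, hε, hsepA⟩ := F0P3cStCharTSRootCount.exists_pos_separating A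
  have hnear : ∀ᶠ y in 𝓝 x, ∀ a ∈ A, ‖u a y - a‖ < ε := by
    rw [Filter.eventually_all_finset]
    intro a ha
    exact F0P3cStCharTSMovingRoot.eventually_norm_sub_lt_of_continuousAt (hu0 a ha) (huc a ha x (hxVa a ha)) hε
  have hdist : ∀ᶠ y in 𝓝 x, ∀ a ∈ A, ∀ a' ∈ A, u a y = u a' y → a = a' := by
    filter_upwards [hnear] with y hy a ha a' ha' he
    by_contra hne
    have h2 := hsepA a ha a' ha' hne
    have h3 : ‖a - a'‖ ≤ ‖u a y - a‖ + ‖u a' y - a'‖ := by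
      calc ‖a - a'‖ = ‖(u a' y - a') - (u a y - a)‖ := by rw [he]; congr 1; abel
        _ ≤ ‖u a' y - a'‖ + ‖u a y - a‖ := norm_sub_le _ _
        _ = ‖u a y - a‖ + ‖u a' y - a'‖ := add_comm _ _
    linarith [hy a ha, hy a' ha']
  -- one open set `O ∋ x` carrying the three eventual facts; `V := O ∩ W ∩ ⋂_{a ∈ A} Va a`
  obtain ⟨O, hOsub, hOopen, hxO⟩ := mem_nhds_iff.1 (hn1.and (hexh.and hdist))
  refine ⟨O ∩ W ∩ ⋂ a ∈ A, Va a, A, u, (hOopen.inter hWopen).inter (isOpen_biInter_finset fun a ha => hVao a ha),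
    ⟨⟨hxO, hx⟩, Set.mem_iInter₂.2 fun a ha => hxVa a ha⟩, fun y hy => hy.1.2, hu0, fun a ha y hy => huc a ha y (Set.mem_iInter₂.1 hy.2 a ha),
    fun a ha y hy => ⟨(hwinV a ha y (Set.mem_iInter₂.1 hy.2 a ha)).1, (hOsub hy.1.1).1 a ha⟩,
    fun y hy => (hOsub hy.1.1).2.2, fun y hy => (hOsub hy.1.1).2.1⟩

end Frame

/-! ## §3 (M3) The matched section, continuous on an open set -/

section Section_

variable (L : Type) [Field L] [NumberField L] [IsCMField L] (v : HeightOneSpectrum (𝓞 ↥(maximalRealSubfield L)))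

/-- **MOVING SECTION, CONTINUOUS ON A NEIGHBOURHOOD (SECTION-ON★).**  Let `V ⊆ U(Φ₃)(L⁺_v)` be open, `y₀ ∈ V`, and `U : U(Φ₃)(L⁺_v) → R` continuous at every point of `V` with,
for every `y ∈ V`, `y` regular and `U(y)` a NORM-ONE ROOT of `charpoly y`.  Then there are an open `V' ∋ y₀`, `V' ⊆ V`, and `s : U(Φ₃)(L⁺_v) → H_v = U(Φ₂) × U(Φ₁)` CONTINUOUS AT
EVERY POINT OF `V'`, such that for all `y ∈ V'`: `s(y)` is `G`-regular, `ι(s(y)) ↔ y`, and its `U(1)`-slot is `U(y)` — the same explicit section as ★ `exists_continuousAt_section`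
(`s(y) = ([[0, (σk)⁻¹], [k, tr y − U]], (U))`, chart `k ∈ {1 − d, δ(1 + d)}` frozen at `y₀`), on the open set `V' = V ∩ {k a unit}`. [cite: Rogawski1990, §4.3 p. 43; §5.4 p. 78; §12.5 pp. 182–184] -/
theorem exists_section_continuousOn (w : PlacesOver L v) (hw : IsCMField.complexConj L • w.1 = w.1) {V : Set (Gqs L v)} (hV : IsOpen V)
    {y₀ : Gqs L v} (hy₀ : y₀ ∈ V)
    (U : Gqs L v → UnitaryGroup.LocalRing L v) (hU : ∀ y ∈ V, ContinuousAt U y)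
    (hev : ∀ y ∈ V, IsRegularElt (y.val : GL (Fin 3) (UnitaryGroup.LocalRing L v)) ∧
      ((y.val : GL (Fin 3) (UnitaryGroup.LocalRing L v)).val.charpoly).IsRoot (U y) ∧ conjLocal L (IsCMField.complexConj L) v (U y) * U y = 1) :
    ∃ (s : Gqs L v → (UnitaryGroup.cmDatum L 2 (Matrix.of fun i j : Fin 2 => if i.val + j.val + 1 = 2 then (1 : L) else 0)).Local v ×
        (UnitaryGroup.cmDatum L 1 (Matrix.of fun i j : Fin 1 => if i.val + j.val + 1 = 1 then (1 : L) else 0)).Local v) (V' : Set (Gqs L v)),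
      IsOpen V' ∧ y₀ ∈ V' ∧ V' ⊆ V ∧ (∀ y ∈ V', ContinuousAt s y) ∧
        ∀ y ∈ V', IsLocalGRegular L v (s y) ∧ IsLocalNormPair L (qsForm L) v (s y) y ∧ finGammaTwo L v (s y) = U y := by
  classical
  haveI : Algebra.IsQuadraticExtension ↥(maximalRealSubfield L) L := IsCMField.isQuadraticExtension L
  haveI hsub : Subsingleton (PlacesOver L v) := PlacesOver.subsingleton_of_smul_eq (IsCMField.complexConj L) (IsCMField.complexConj_ne_one L) w hw
  set σ := conjLocal L (IsCMField.complexConj L) v with hσ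
  have hσσ : ∀ x, σ (σ x) = x := fun x => conjLocal_conjLocal_cm L v x
  have hσc : Continuous σ := UnitaryGroup.continuous_conjLocal L (IsCMField.complexConj L) v
  -- the matrix of `y`, its determinant and trace
  have hM : Continuous fun y : Gqs L v => ((y.val : GL (Fin 3) (UnitaryGroup.LocalRing L v)).val : Matrix (Fin 3) (Fin 3) (UnitaryGroup.LocalRing L v)) :=
    Units.continuous_val.comp continuous_subtype_val
  set d : Gqs L v → UnitaryGroup.LocalRing L v := fun y => (y.val : GL (Fin 3) (UnitaryGroup.LocalRing L v)).val.det * σ (U y) with hd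
  set t : Gqs L v → UnitaryGroup.LocalRing L v := fun y => (y.val : GL (Fin 3) (UnitaryGroup.LocalRing L v)).val.trace - U y with ht
  have hdc : ∀ y ∈ V, ContinuousAt d y := fun y hy => ((continuous_id.matrix_det.comp hM).continuousAt).mul (hσc.continuousAt.comp (hU y hy))
  have htc : ∀ y ∈ V, ContinuousAt t y := fun y hy => ((continuous_id.matrix_trace.comp hM).continuousAt).sub (hU y hy)
  -- the invariants along the moving root (★ FIBRE-REALISE)
  have hinv : ∀ y : Gqs L v, ((y.val : GL (Fin 3) (UnitaryGroup.LocalRing L v)).val.charpoly).IsRoot (U y) → σ (U y) * U y = 1 →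
      σ (d y) * d y = 1 ∧ σ (t y) * d y = t y := fun y hr h1 => by
    obtain ⟨h₁, h₂, -⟩ := F0P3cStCharTSFibreRealise.invariants_of_norm_one_root L v y hr h1
    exact ⟨h₁, h₂⟩
  -- units of `R`: read at the unique place
  have hunit : ∀ x : UnitaryGroup.LocalRing L v, x w ≠ 0 → IsUnit x := fun x hx =>
    isUnit_localRing_of_forall_apply_ne_zero fun w' => by rw [Subsingleton.elim w' w]; exact hx
  -- THE CHART `k` (frozen at `y₀`): continuous at every point of `V`, a unit at `y₀`, and `k = −d·σk` wherever `σd·d = 1`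
  obtain ⟨k, hkc, hk0, hkrel⟩ : ∃ k : Gqs L v → UnitaryGroup.LocalRing L v, (∀ y ∈ V, ContinuousAt k y) ∧ IsUnit (k y₀) ∧
      ∀ y, σ (d y) * d y = 1 → k y = -d y * σ (k y) := by
    by_cases h1 : IsUnit (1 - d y₀)
    · refine ⟨fun y => 1 - d y, fun y hy => continuousAt_const.sub (hdc y hy), h1, fun y hy => ?_⟩
      rw [map_sub, map_one]
      linear_combination (-1 : UnitaryGroup.LocalRing L v) * hy
    · obtain ⟨δ, hσδ, hδu⟩ := exists_conj_eq_neg_isUnit L v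
      refine ⟨fun y => δ * (1 + d y), fun y hy => continuousAt_const.mul (continuousAt_const.add (hdc y hy)), ?_, fun y hy => ?_⟩
      · -- `1 − d(y₀)` is not a unit ⇒ `d(y₀)_w = 1` ⇒ `(δ(1 + d(y₀)))_w = 2 δ_w ≠ 0`
        have hdw : d y₀ w = 1 := by
          by_contra hne
          exact h1 (hunit _ (by rw [Pi.sub_apply, Pi.one_apply]; exact sub_ne_zero.2 (Ne.symm hne)))
        refine hunit _ ?_
        show (δ * (1 + d y₀)) w ≠ 0
        rw [Pi.mul_apply, Pi.add_apply, Pi.one_apply, hdw]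
        exact mul_ne_zero ((Pi.isUnit_iff.1 hδu) w).ne_zero (by norm_num)
      · rw [map_mul, map_add, map_one, hσδ]
        linear_combination (-δ) * hy
  -- THE GOOD OPEN SET `V' = V ∩ {k a unit}`
  have hkon : ContinuousOn k V := continuousOn_of_forall_continuousAt hkc
  set V' : Set (Gqs L v) := V ∩ k ⁻¹' {x | IsUnit x} with hV'
  have hV'open : IsOpen V' := hkon.isOpen_inter_preimage hV Units.isOpen
  have hy₀V' : y₀ ∈ V' := ⟨hy₀, hk0⟩
  -- THE SECTION, pointwise
  have hsec : ∀ y : Gqs L v, ∃ sy : (UnitaryGroup.cmDatum L 2 (Matrix.of fun i j : Fin 2 => if i.val + j.val + 1 = 2 then (1 : L) else 0)).Local v ×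
        (UnitaryGroup.cmDatum L 1 (Matrix.of fun i j : Fin 1 => if i.val + j.val + 1 = 1 then (1 : L) else 0)).Local v,
      (((y.val : GL (Fin 3) (UnitaryGroup.LocalRing L v)).val.charpoly).IsRoot (U y) ∧ σ (U y) * U y = 1 ∧ IsUnit (k y)) →
        (sy.1.val.val : Matrix (Fin 2) (Fin 2) (UnitaryGroup.LocalRing L v)) = !![0, Ring.inverse (σ (k y)); k y, t y] ∧
        ((sy.1.val⁻¹).val : Matrix (Fin 2) (Fin 2) (UnitaryGroup.LocalRing L v)) = !![σ (d y) * t y, -(σ (d y) * Ring.inverse (σ (k y))); -(σ (d y) * k y), 0] ∧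
        (sy.2.val.val : Matrix (Fin 1) (Fin 1) (UnitaryGroup.LocalRing L v)) = !![U y] ∧
        ((sy.2.val⁻¹).val : Matrix (Fin 1) (Fin 1) (UnitaryGroup.LocalRing L v)) = !![σ (U y)] := by
    intro y
    by_cases hc : ((y.val : GL (Fin 3) (UnitaryGroup.LocalRing L v)).val.charpoly).IsRoot (U y) ∧ σ (U y) * U y = 1 ∧ IsUnit (k y)
    · obtain ⟨hr, h1, hky⟩ := hc
      obtain ⟨hdd, htt⟩ := hinv y hr h1
      have hσku : IsUnit (σ (k y)) := hky.map σ
      obtain ⟨g, hgmem, hgval, hginv, -, -⟩ := exists_mem_local_two_of_invariants (t y) (d y) (k y) hdd htt (hkrel y hdd) hσku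
      have he : (↑(hσku.unit⁻¹) : UnitaryGroup.LocalRing L v) = Ring.inverse (σ (k y)) := by
        have h' : Ring.inverse ((hσku.unit : UnitaryGroup.LocalRing L v)) = ↑(hσku.unit⁻¹) := Ring.inverse_unit hσku.unit
        rw [hσku.unit_spec] at h'
        exact h'.symm
      have huu : U y * σ (U y) = 1 := by rw [mul_comm]; exact h1
      have hdet1 : IsUnit (!![U y] : Matrix (Fin 1) (Fin 1) (UnitaryGroup.LocalRing L v)).det := by
        rw [Matrix.det_fin_one_of]; exact isUnit_iff_exists_inv.2 ⟨σ (U y), huu⟩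
      refine ⟨(⟨g, hgmem⟩, ⟨Matrix.nonsingInvUnit (!![U y]) hdet1, F0P3cStCharTSFibreRealise.nonsingInvUnit_mem_local_one L v h1 hdet1⟩), fun _ => ⟨?_, ?_, ?_, ?_⟩⟩
      · rw [← he]; exact hgval
      · rw [← he]; exact hginv
      · rfl
      · change ((Matrix.nonsingInvUnit (!![U y]) hdet1)⁻¹ : (Matrix (Fin 1) (Fin 1) (UnitaryGroup.LocalRing L v))ˣ).val = !![σ (U y)]
        have hBA : (!![σ (U y)] : Matrix (Fin 1) (Fin 1) (UnitaryGroup.LocalRing L v)) * !![U y] = 1 := by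
          ext i j; fin_cases i; fin_cases j
          simp [Matrix.mul_apply, h1]
        exact Matrix.inv_eq_left_inv hBA
    · exact ⟨1, fun h => absurd h hc⟩
  choose s hs using hsec
  -- the good set, pointwise on `V'` and eventually near every point of `V'`
  have hgoodV : ∀ y ∈ V', IsRegularElt (y.val : GL (Fin 3) (UnitaryGroup.LocalRing L v)) ∧
      ((y.val : GL (Fin 3) (UnitaryGroup.LocalRing L v)).val.charpoly).IsRoot (U y) ∧ σ (U y) * U y = 1 ∧ IsUnit (k y) := fun y hy =>
    ⟨(hev y hy.1).1, (hev y hy.1).2.1, (hev y hy.1).2.2, hy.2⟩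
  have hgood : ∀ y₁ ∈ V', ∀ᶠ y in 𝓝 y₁, IsRegularElt (y.val : GL (Fin 3) (UnitaryGroup.LocalRing L v)) ∧
      ((y.val : GL (Fin 3) (UnitaryGroup.LocalRing L v)).val.charpoly).IsRoot (U y) ∧ σ (U y) * U y = 1 ∧ IsUnit (k y) := fun y₁ hy₁ =>
    Filter.mem_of_superset (hV'open.mem_nhds hy₁) fun y hy => hgoodV y hy
  refine ⟨s, V', hV'open, hy₀V', inter_subset_left, fun y₁ hy₁ => ?_, fun y hy => ?_⟩
  · -- CONTINUITY AT EVERY `y₁ ∈ V'`: on the good set the matrices and inverses are explicit and continuous at `y₁`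
    have hk1 : IsUnit (k y₁) := hy₁.2
    have hkc1 : ContinuousAt k y₁ := hkc y₁ hy₁.1
    have hU1 : ContinuousAt U y₁ := hU y₁ hy₁.1
    have hσk : ContinuousAt (fun y => σ (k y)) y₁ := hσc.continuousAt.comp hkc1
    have hE : ContinuousAt (fun y => Ring.inverse (σ (k y))) y₁ := by
      obtain ⟨u₀, hu₀⟩ := hk1.map σ
      have hRi : ContinuousAt Ring.inverse (σ (k y₁)) := by
        have := NormedRing.inverse_continuousAt u₀
        rwa [hu₀] at this
      exact ContinuousAt.comp (g := Ring.inverse) (f := fun y => σ (k y)) hRi hσk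
    have hσd : ContinuousAt (fun y => σ (d y)) y₁ := hσc.continuousAt.comp (hdc y₁ hy₁.1)
    have hσU : ContinuousAt (fun y => σ (U y)) y₁ := hσc.continuousAt.comp hU1
    have h1v : ContinuousAt (fun y => ((s y).1.val.val : Matrix (Fin 2) (Fin 2) (UnitaryGroup.LocalRing L v))) y₁ := by
      refine (continuousAt_matrix_two L v (continuousAt_const : ContinuousAt (fun _ : Gqs L v => (0 : UnitaryGroup.LocalRing L v)) y₁) hE hkc1 (htc y₁ hy₁.1)).congr ?_
      filter_upwards [hgood y₁ hy₁] with y hy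
      exact ((hs y ⟨hy.2.1, hy.2.2.1, hy.2.2.2⟩).1).symm
    have h1i : ContinuousAt (fun y => (((s y).1.val⁻¹).val : Matrix (Fin 2) (Fin 2) (UnitaryGroup.LocalRing L v))) y₁ := by
      refine (continuousAt_matrix_two L v (hσd.mul (htc y₁ hy₁.1)) (hσd.mul hE).neg (hσd.mul hkc1).neg
        (continuousAt_const : ContinuousAt (fun _ : Gqs L v => (0 : UnitaryGroup.LocalRing L v)) y₁)).congr ?_
      filter_upwards [hgood y₁ hy₁] with y hy
      exact ((hs y ⟨hy.2.1, hy.2.2.1, hy.2.2.2⟩).2.1).symm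
    have h2v : ContinuousAt (fun y => ((s y).2.val.val : Matrix (Fin 1) (Fin 1) (UnitaryGroup.LocalRing L v))) y₁ := by
      refine (continuousAt_matrix_one L v hU1).congr ?_
      filter_upwards [hgood y₁ hy₁] with y hy
      exact ((hs y ⟨hy.2.1, hy.2.2.1, hy.2.2.2⟩).2.2.1).symm
    have h2i : ContinuousAt (fun y => (((s y).2.val⁻¹).val : Matrix (Fin 1) (Fin 1) (UnitaryGroup.LocalRing L v))) y₁ := by
      refine (continuousAt_matrix_one L v hσU).congr ?_
      filter_upwards [hgood y₁ hy₁] with y hy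
      exact ((hs y ⟨hy.2.1, hy.2.2.1, hy.2.2.2⟩).2.2.2).symm
    exact (continuousAt_localTwo_of_matrix L v (fun y => (s y).1) h1v h1i).prodMk (continuousAt_localOne_of_matrix L v (fun y => (s y).2) h2v h2i)
  · -- MATCHING on `V'` (★ `isLocalNormPair_of_entries`)
    obtain ⟨hreg, hr, h1, hky⟩ := hgoodV y hy
    obtain ⟨hs1, -, hs2, -⟩ := hs y ⟨hr, h1, hky⟩
    have hσku : IsUnit (σ (k y)) := hky.map σ
    have he : Ring.inverse (σ (k y)) * σ (k y) = 1 := Ring.inverse_mul_cancel _ hσku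
    have hkk : k y = -((y.val : GL (Fin 3) (UnitaryGroup.LocalRing L v)).val.det * σ (U y)) * σ (k y) := hkrel y (hinv y hr h1).1
    have hs2' : ((s y).2.val : GL (Fin 1) (UnitaryGroup.LocalRing L v)).val 0 0 = U y := by rw [hs2]; rfl
    exact F0P3cStCharTSFibreRealise.isLocalNormPair_of_entries L v y hreg hr h1 he hkk (s y) hs1 hs2'

end Section_

end Summit.HodgeConjecture.HodgeConjecture.Cruxes.H413.F0P3cStCharTSMovingFrame

end
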